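import Literature.NumberTheory.EllipticCurves.BhargavaShankarLocalMasses
import Literature.NumberTheory.EllipticCurves.BinaryQuarticFormsProofs
import Literature.NumberTheory.EllipticCurves.BhargavaShankarCountingProofs
import Literature.NumberTheory.EllipticCurves.BinaryQuarticMinimisationProofs
import Mathlib.Analysis.Complex.Polynomial.Basic
import Mathlib.FieldTheory.SplittingField.Construction
import Mathlib.Algebra.QuadraticDiscriminant
import HarnessLib

/-!
# Real types of binary quartic forms: a form of negative discriminant has a real zero;
# `N(V_ℤ^{(2)}; X) = 2 N(V_ℤ^{(2+)}; X)` and additivity of `N(·; X)` over the real types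

`Proofs` companion of `BinaryQuarticForms.lean` / `BhargavaShankarLocalMasses.lean` (theorems
only), supplying the elementary real-algebra facts behind Bhargava–Shankar's partition
`V_ℝ = V_ℝ^{(0)} ⊔ V_ℝ^{(1)} ⊔ V_ℝ^{(2+)} ⊔ V_ℝ^{(2−)}` (Ann. of Math. 181 (2015), §2.1) in the
tree's rendering (`fourRealRoots = {Δ > 0, indefinite}`, `twoRealRoots = {Δ < 0}`,
`noRealRoots = {definite}`, `posDefinite`), which are used to combine the three counts of
Thm 2.1 (`bhargavaShankar_classCount`) into the count
`N(V_ℤ^{(0)} ∪ V_ℤ^{(2+)} ∪ V_ℤ^{(1)}; X)` appearing in eq. (31) (held arXiv text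
`arXiv:1006.1002v2`, p. 34).

## Contents (all proved)

1. `BinaryQuartic.exists_eval_eq_zero_of_disc_neg`: **a real binary quartic form with `Δ < 0`
   has a nontrivial real zero**, hence is not definite (`not_isDefinite_of_disc_neg`); so
   `twoRealRoots` and `noRealRoots` are disjoint. Proof without root counting: if `a = 0` then
   `(1,0)` is a zero; otherwise an irreducible factor of `f(x,1) ∈ ℝ[X]` has degree `≤ 2`
   (Mathlib `Irreducible.degree_le_two`); a linear factor gives a zero, and a factorisation
   `f(x,1) = q₁q₂` into two real quadratics without real roots gives
   `Δ(f) = Δ(q₁)Δ(q₂)·Res(q₁,q₂)² ≥ 0` (both `Δ(qᵢ) < 0`), a polynomial identity.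
2. `GL2ZEquiv.mem_posDefinite_iff`: `V_ℤ^{(2+)}` is `GL₂(ℤ)`-stable.
3. `gl2zClassCount_noRealRoots`: **`N(V_ℤ^{(2)}; X) = 2·N(V_ℤ^{(2+)}; X)`** — `f ↦ −f` is a
   bijection between the `GL₂(ℤ)`-orbits of positive and of negative definite irreducible forms
   of height `< X` (it preserves `I`, negates `J`, so preserves `H`, and commutes with
   substitutions), as used in the third line of display (31) of the source
   (`(1/4 + 1/4)·Vol(R₁⁺)`).
4. `gl2zClassCount_union_three`: for finite orbit sets,
   `N(V_ℤ^{(0)} ∪ V_ℤ^{(2+)} ∪ V_ℤ^{(1)}; X) = N(V_ℤ^{(0)}; X) + N(V_ℤ^{(2+)}; X) + N(V_ℤ^{(1)}; X)`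
   (the three orbit families are pairwise disjoint by 1–2 and `GL₂(ℤ)`-invariance of `Δ` and of
   definiteness).

## References

* M. Bhargava, A. Shankar, Ann. of Math. (2) 181 (2015) 191–242 = arXiv:1006.1002, §2.1 and
  §5.4 eq. (31). [cite: BhargavaShankarAnnals2015, §2.1]

## Design

No definitions; negative definite forms are written `(-1 : ℤ) • f ∈ posDefinite`.
-/

noncomputable section

open scoped Classical
open Polynomial

namespace Literature.NumberTheory.EllipticCurves

namespace BinaryQuartic

/-! ## A real form of negative discriminant has a real zero -/

/-- Coefficients of a product of two quadratics `(α₁X² + β₁X + γ₁)(α₂X² + β₂X + γ₂)`. [folklore] -/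
theorem quadratic_mul_quadratic (α₁ β₁ γ₁ α₂ β₂ γ₂ : ℝ) :
    (C α₁ * X ^ 2 + C β₁ * X + C γ₁) * (C α₂ * X ^ 2 + C β₂ * X + C γ₂) =
      C (α₁ * α₂) * X ^ 4 + C (α₁ * β₂ + β₁ * α₂) * X ^ 3 + C (α₁ * γ₂ + β₁ * β₂ + γ₁ * α₂) * X ^ 2 +
        C (β₁ * γ₂ + γ₁ * β₂) * X + C (γ₁ * γ₂) := by
  simp only [map_add, map_mul]
  ring

/-- Coefficient extraction for an explicit quartic `C p₄ X⁴ + C p₃ X³ + C p₂ X² + C p₁ X + C p₀`. [folklore] -/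
theorem coeff_explicit_quartic (p₄ p₃ p₂ p₁ p₀ : ℝ) (n : ℕ) :
    (C p₄ * X ^ 4 + C p₃ * X ^ 3 + C p₂ * X ^ 2 + C p₁ * X + C p₀).coeff n =
      if n = 4 then p₄ else if n = 3 then p₃ else if n = 2 then p₂ else if n = 1 then p₁
        else if n = 0 then p₀ else 0 := by
  simp only [coeff_add, coeff_C_mul, coeff_X_pow, coeff_X, coeff_C]
  rcases n with _ | _ | _ | _ | _ | n <;> simp

/-- **The discriminant of a product of two quadratics**:
`Δ(q₁q₂) = Δ(q₁)·Δ(q₂)·Res(q₁,q₂)²` for the tree's explicit quartic discriminant, with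
`Res(q₁,q₂) = (α₁γ₂ − α₂γ₁)² − (α₁β₂ − α₂β₁)(β₁γ₂ − β₂γ₁)` (a polynomial identity). [folklore] -/
theorem disc_of_quadratic_mul_quadratic (f : BinaryQuartic ℝ) {α₁ β₁ γ₁ α₂ β₂ γ₂ : ℝ}
    (ha : f.a = α₁ * α₂) (hb : f.b = α₁ * β₂ + β₁ * α₂) (hc : f.c = α₁ * γ₂ + β₁ * β₂ + γ₁ * α₂)
    (hd : f.d = β₁ * γ₂ + γ₁ * β₂) (he : f.e = γ₁ * γ₂) :
    f.disc = (β₁ ^ 2 - 4 * α₁ * γ₁) * (β₂ ^ 2 - 4 * α₂ * γ₂) *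
      ((α₁ * γ₂ - α₂ * γ₁) ^ 2 - (α₁ * β₂ - α₂ * β₁) * (β₁ * γ₂ - β₂ * γ₁)) ^ 2 := by
  simp only [disc, ha, hb, hc, hd, he]
  ring

/-- A real quadratic polynomial `αX² + βX + γ` (`α ≠ 0`) without real roots has negative
discriminant. [folklore] -/
theorem discrim_neg_of_no_root {α β γ : ℝ} (hα : α ≠ 0)
    (h : ∀ x : ℝ, α * x ^ 2 + β * x + γ ≠ 0) : β ^ 2 - 4 * α * γ < 0 := by
  by_contra hge
  push Not at hge
  have hd : discrim α β γ = Real.sqrt (discrim α β γ) * Real.sqrt (discrim α β γ) := by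
    rw [Real.mul_self_sqrt]
    rw [discrim]; linarith
  obtain ⟨x, hx⟩ := exists_quadratic_eq_zero hα ⟨_, hd⟩
  exact h x (by linear_combination hx)

/-- **A real binary quartic form of negative discriminant has a nontrivial real zero**
(so it has real roots in `ℙ¹(ℝ)`: Bhargava–Shankar 2015, §2.1, fact 1, "`4I³ − J² < 0` … this
orbit lies in `V_ℝ^{(1)}`"; here the elementary consequence needed). Proof: `a = 0` gives the
zero `(1,0)`; otherwise factor `f(x,1)` over `ℝ` using that real irreducible polynomials have
degree `≤ 2`; a linear factor gives a zero, two rootless quadratic factors give `Δ ≥ 0`.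
[cite: BhargavaShankarAnnals2015, §2.1 (fact 1)] -/
theorem exists_eval_eq_zero_of_disc_neg (f : BinaryQuartic ℝ) (hdisc : f.disc < 0) :
    ∃ x y : ℝ, (x ≠ 0 ∨ y ≠ 0) ∧ f.eval x y = 0 := by
  by_cases ha : f.a = 0
  · exact ⟨1, 0, Or.inl one_ne_zero, by simp [eval, ha]⟩
  -- reduce to roots of `g = f(x,1)`
  suffices hroot : ∃ x : ℝ, f.toPoly.eval x = 0 by
    obtain ⟨x, hx⟩ := hroot
    exact ⟨x, 1, Or.inr one_ne_zero, by rwa [eval_toPoly] at hx⟩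
  by_contra hnoroot
  push Not at hnoroot
  have hdeg : f.toPoly.natDegree = 4 := natDegree_toPoly ha
  -- an irreducible factor `q` of degree `1` or `2`
  set q := f.toPoly.factor with hq
  have hqirr : Irreducible q := irreducible_factor _
  have hqdvd : q ∣ f.toPoly := factor_dvd_of_natDegree_ne_zero (by rw [hdeg]; norm_num)
  obtain ⟨h, hgh⟩ := hqdvd
  have hq0 : q ≠ 0 := hqirr.ne_zero
  have hh0 : h ≠ 0 := by
    rintro rfl; rw [mul_zero] at hgh; exact toPoly_ne_zero ha hgh
  have hqdeg2 : q.natDegree ≤ 2 := hqirr.natDegree_le_two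
  have hqdeg1 : 1 ≤ q.natDegree := by
    have := Polynomial.natDegree_pos_iff_degree_pos.mpr (degree_pos_of_irreducible hqirr)
    omega
  have hsum : q.natDegree + h.natDegree = 4 := by
    rw [← hdeg, hgh, natDegree_mul hq0 hh0]
  -- no factor of `f(x,1)` has a real root
  have hq_noroot : ∀ x : ℝ, q.eval x ≠ 0 := fun x hx ↦
    hnoroot x (by rw [hgh, eval_mul, hx, zero_mul])
  have hh_noroot : ∀ x : ℝ, h.eval x ≠ 0 := fun x hx ↦
    hnoroot x (by rw [hgh, eval_mul, hx, mul_zero])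
  -- `q` cannot be linear
  have hqdeg : q.natDegree = 2 := by
    rcases Nat.lt_or_ge q.natDegree 2 with hlt | hge
    · exfalso
      have h1 : q.natDegree = 1 := by omega
      obtain ⟨c0, hc0⟩ : ∃ c0, q.coeff 0 = c0 := ⟨_, rfl⟩
      obtain ⟨c1, hc1'⟩ : ∃ c1, q.coeff 1 = c1 := ⟨_, rfl⟩
      have hq1 : q = C c1 * X + C c0 := by
        rw [← hc0, ← hc1']; exact eq_X_add_C_of_natDegree_le_one h1.le
      have hc1 : c1 ≠ 0 := by
        intro h0
        have := congrArg natDegree hq1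
        rw [h0, map_zero, zero_mul, zero_add, natDegree_C] at this
        omega
      apply hq_noroot (-c0 / c1)
      rw [hq1]
      simp only [eval_add, eval_mul, eval_C, eval_X]
      field_simp
      ring
    · omega
  have hhdeg : h.natDegree = 2 := by omega
  -- write both quadratics explicitly
  have hq2 : q = C (q.coeff 2) * X ^ 2 + C (q.coeff 1) * X + C (q.coeff 0) := by
    conv_lhs => rw [q.as_sum_range_C_mul_X_pow, hqdeg]
    simp [Finset.sum_range_succ]
    ring
  have hh2 : h = C (h.coeff 2) * X ^ 2 + C (h.coeff 1) * X + C (h.coeff 0) := by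
    conv_lhs => rw [h.as_sum_range_C_mul_X_pow, hhdeg]
    simp [Finset.sum_range_succ]
    ring
  have hqlead : q.coeff 2 ≠ 0 := by
    have := hq0; contrapose! this
    rw [← leadingCoeff_eq_zero, leadingCoeff, hqdeg, this]
  have hhlead : h.coeff 2 ≠ 0 := by
    have := hh0; contrapose! this
    rw [← leadingCoeff_eq_zero, leadingCoeff, hhdeg, this]
  -- negative discriminants
  have hdq : q.coeff 1 ^ 2 - 4 * q.coeff 2 * q.coeff 0 < 0 := by
    refine discrim_neg_of_no_root hqlead fun x hx ↦ hq_noroot x ?_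
    rw [hq2]; simp only [eval_add, eval_mul, eval_C, eval_X, eval_pow]; linear_combination hx
  have hdh : h.coeff 1 ^ 2 - 4 * h.coeff 2 * h.coeff 0 < 0 := by
    refine discrim_neg_of_no_root hhlead fun x hx ↦ hh_noroot x ?_
    rw [hh2]; simp only [eval_add, eval_mul, eval_C, eval_X, eval_pow]; linear_combination hx
  -- compare coefficients of `f(x,1) = q h`
  have hprod : f.toPoly = C (q.coeff 2 * h.coeff 2) * X ^ 4 +
      C (q.coeff 2 * h.coeff 1 + q.coeff 1 * h.coeff 2) * X ^ 3 +
      C (q.coeff 2 * h.coeff 0 + q.coeff 1 * h.coeff 1 + q.coeff 0 * h.coeff 2) * X ^ 2 +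
      C (q.coeff 1 * h.coeff 0 + q.coeff 0 * h.coeff 1) * X + C (q.coeff 0 * h.coeff 0) := by
    rw [hgh]
    conv_lhs => rw [hq2, hh2]
    exact quadratic_mul_quadratic _ _ _ _ _ _
  have hf : f.toPoly = C f.a * X ^ 4 + C f.b * X ^ 3 + C f.c * X ^ 2 + C f.d * X + C f.e := rfl
  have hcoef : ∀ n, (C f.a * X ^ 4 + C f.b * X ^ 3 + C f.c * X ^ 2 + C f.d * X + C f.e).coeff n =
      (C (q.coeff 2 * h.coeff 2) * X ^ 4 +
      C (q.coeff 2 * h.coeff 1 + q.coeff 1 * h.coeff 2) * X ^ 3 +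
      C (q.coeff 2 * h.coeff 0 + q.coeff 1 * h.coeff 1 + q.coeff 0 * h.coeff 2) * X ^ 2 +
      C (q.coeff 1 * h.coeff 0 + q.coeff 0 * h.coeff 1) * X + C (q.coeff 0 * h.coeff 0)).coeff n := by
    intro n; rw [← hf, ← hprod]
  have ha' := hcoef 4
  have hb' := hcoef 3
  have hc' := hcoef 2
  have hd' := hcoef 1
  have he' := hcoef 0
  simp only [coeff_explicit_quartic] at ha' hb' hc' hd' he'
  simp only [if_true, show (3 : ℕ) ≠ 4 by norm_num, show (2 : ℕ) ≠ 4 by norm_num,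
    show (2 : ℕ) ≠ 3 by norm_num, show (1 : ℕ) ≠ 4 by norm_num, show (1 : ℕ) ≠ 3 by norm_num,
    show (1 : ℕ) ≠ 2 by norm_num, show (0 : ℕ) ≠ 4 by norm_num, show (0 : ℕ) ≠ 3 by norm_num,
    show (0 : ℕ) ≠ 2 by norm_num, show (0 : ℕ) ≠ 1 by norm_num, if_false] at ha' hb' hc' hd' he'
  have hD := disc_of_quadratic_mul_quadratic f ha' hb' hc' hd' he'
  have hpos : 0 < (q.coeff 1 ^ 2 - 4 * q.coeff 2 * q.coeff 0) * (h.coeff 1 ^ 2 - 4 * h.coeff 2 * h.coeff 0) :=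
    mul_pos_of_neg_of_neg hdq hdh
  have : 0 ≤ f.disc := by
    rw [hD]
    exact mul_nonneg hpos.le (sq_nonneg _)
  linarith

/-- A real binary quartic form of negative discriminant is not definite (it vanishes at a
nonzero vector). [cite: BhargavaShankarAnnals2015, §2.1 (fact 1)] -/
theorem not_isDefinite_of_disc_neg (f : BinaryQuartic ℝ) (hdisc : f.disc < 0) : ¬ f.IsDefinite := by
  obtain ⟨x, y, hxy, h0⟩ := exists_eval_eq_zero_of_disc_neg f hdisc
  rintro (hpos | hneg)
  · exact (hpos x y hxy).ne' h0
  · exact (hneg x y hxy).ne h0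

/-- `V_ℤ^{(1)} ∩ V_ℤ^{(2)} = ∅`: an integral form with `Δ < 0` is not definite. [cite: BhargavaShankarAnnals2015, §2.1] -/
theorem not_mem_noRealRoots_of_mem_twoRealRoots {f : BinaryQuartic ℤ} (hf : f ∈ twoRealRoots) :
    f ∉ noRealRoots := by
  have hd : (f.map (Int.castRingHom ℝ)).disc < 0 := by
    rw [disc_map, eq_intCast]; exact_mod_cast (show f.disc < 0 from hf)
  exact not_isDefinite_of_disc_neg _ hd

/-! ## `V_ℤ^{(2+)}` is `GL₂(ℤ)`-stable; negation swaps `V_ℤ^{(2+)}` and `V_ℤ^{(2−)}` -/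

/-- Positive definiteness of a real form is invariant under invertible real substitutions. [folklore] -/
theorem posDef_subst_iff (f : BinaryQuartic ℝ) {γ : Matrix (Fin 2) (Fin 2) ℝ} (hγ : γ.det ≠ 0) :
    (∀ x y : ℝ, (x ≠ 0 ∨ y ≠ 0) → 0 < (f.subst γ).eval x y) ↔
      (∀ x y : ℝ, (x ≠ 0 ∨ y ≠ 0) → 0 < f.eval x y) := by
  have nz : ∀ (δ : Matrix (Fin 2) (Fin 2) ℝ), δ.det ≠ 0 → ∀ x y : ℝ, (x ≠ 0 ∨ y ≠ 0) →
      (x * δ 0 0 + y * δ 1 0 ≠ 0 ∨ x * δ 0 1 + y * δ 1 1 ≠ 0) := by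
    intro δ hδ x y hxy
    by_contra h0
    simp only [ne_eq, not_or, not_not] at h0
    obtain ⟨h1, h2⟩ := h0
    have hx : x * δ.det = 0 := by
      rw [Matrix.det_fin_two]; linear_combination δ 1 1 * h1 - δ 1 0 * h2
    have hy : y * δ.det = 0 := by
      rw [Matrix.det_fin_two]; linear_combination (-(δ 0 1)) * h1 + δ 0 0 * h2
    rcases hxy with hx0 | hy0
    · exact hx0 ((mul_eq_zero.mp hx).resolve_right hδ)
    · exact hy0 ((mul_eq_zero.mp hy).resolve_right hδ)
  have key : ∀ (g : BinaryQuartic ℝ) (δ : Matrix (Fin 2) (Fin 2) ℝ), δ.det ≠ 0 →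
      (∀ x y : ℝ, (x ≠ 0 ∨ y ≠ 0) → 0 < g.eval x y) →
        ∀ x y : ℝ, (x ≠ 0 ∨ y ≠ 0) → 0 < (g.subst δ).eval x y := by
    intro g δ hδ hpos x y hxy
    rw [eval_subst]; exact hpos _ _ (nz δ hδ x y hxy)
  refine ⟨fun h ↦ ?_, key f γ hγ⟩
  have hγu : IsUnit γ.det := isUnit_iff_ne_zero.mpr hγ
  have hinv : (γ⁻¹).det ≠ 0 := isUnit_iff_ne_zero.mp (Matrix.isUnit_nonsing_inv_det_iff.mpr hγu)
  have := key (f.subst γ) γ⁻¹ hinv h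
  rwa [← subst_mul, Matrix.nonsing_inv_mul γ hγu, subst_one] at this

/-- `V_ℤ^{(2+)}` is `GL₂(ℤ)`-invariant. [cite: BhargavaShankarAnnals2015, §2.1] -/
theorem GL2ZEquiv.mem_posDefinite_iff {f g : BinaryQuartic ℤ} (h : GL2ZEquiv f g) :
    g ∈ posDefinite ↔ f ∈ posDefinite := by
  obtain ⟨γ, hγ, rfl⟩ := h
  have hdet : (γ.map (Int.castRingHom ℝ)).det ≠ 0 := by
    rw [show γ.map (Int.castRingHom ℝ) = (Int.castRingHom ℝ).mapMatrix γ from rfl,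
      ← RingHom.map_det]
    rcases Int.isUnit_iff.mp hγ with h1 | h1 <;> simp [h1]
  show (∀ x y : ℝ, (x ≠ 0 ∨ y ≠ 0) → 0 < ((f.subst γ).map (Int.castRingHom ℝ)).eval x y) ↔
    (∀ x y : ℝ, (x ≠ 0 ∨ y ≠ 0) → 0 < (f.map (Int.castRingHom ℝ)).eval x y)
  rw [map_subst, posDef_subst_iff _ hdet]

/-- Negation is an involution on forms. [folklore] -/
theorem neg_one_smul_neg_one_smul {R : Type*} [CommRing R] (f : BinaryQuartic R) :
    (-1 : R) • ((-1 : R) • f) = f := by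
  rw [smul_smul]; norm_num

/-- A definite form is positive definite or its negative is. [cite: BhargavaShankarAnnals2015, §2.1 (V^{(2)} = V^{(2+)} ⊔ V^{(2−)})] -/
theorem mem_noRealRoots_iff_posDefinite (f : BinaryQuartic ℤ) :
    f ∈ noRealRoots ↔ f ∈ posDefinite ∨ (-1 : ℤ) • f ∈ posDefinite := by
  have hneg : ∀ x y : ℝ, (((-1 : ℤ) • f).map (Int.castRingHom ℝ)).eval x y =
      -((f.map (Int.castRingHom ℝ)).eval x y) := by
    intro x y; rw [TwoCovering.map_smul_form, eval_smul]; simp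
  simp only [noRealRoots, posDefinite, Set.mem_setOf_eq, IsDefinite, hneg, neg_pos]

/-- A form cannot be both positive and negative definite. [folklore] -/
theorem not_posDefinite_and_neg {f : BinaryQuartic ℤ} (h1 : f ∈ posDefinite)
    (h2 : (-1 : ℤ) • f ∈ posDefinite) : False := by
  have hneg : (((-1 : ℤ) • f).map (Int.castRingHom ℝ)).eval 1 0 =
      -((f.map (Int.castRingHom ℝ)).eval 1 0) := by
    rw [TwoCovering.map_smul_form, eval_smul]; simp
  have a := h1 1 0 (Or.inl one_ne_zero)
  have b := h2 1 0 (Or.inl one_ne_zero)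
  rw [hneg] at b
  linarith

/-- Negation preserves the height (`I(−f) = I(f)`, `J(−f) = −J(f)`). [folklore] -/
theorem height_neg_one_smul (f : BinaryQuartic ℤ) : ((-1 : ℤ) • f).height = f.height := by
  simp only [height, heightIJ, I_smul, J_smul]
  norm_num

/-- Negation preserves irreducibility. [folklore] -/
theorem isIrreducible_neg_one_smul_iff (f : BinaryQuartic ℤ) :
    ((-1 : ℤ) • f).IsIrreducible ↔ f.IsIrreducible := by
  have hpoly : (((-1 : ℤ) • f).map (Int.castRingHom ℚ)).toPoly = -(f.map (Int.castRingHom ℚ)).toPoly := by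
    rw [TwoCovering.map_smul_form]
    simp only [toPoly, smul_a, smul_b, smul_c, smul_d, smul_e, map_neg, map_one, neg_mul, one_mul]
    ring
  simp only [IsIrreducible, smul_a, neg_mul, one_mul, neg_ne_zero, hpoly]
  refine and_congr_right fun _ ↦ ?_
  have : -(f.map (Int.castRingHom ℚ)).toPoly = ((-1 : ℚ[X]ˣ) : ℚ[X]) * (f.map (Int.castRingHom ℚ)).toPoly := by
    simp
  rw [this, irreducible_units_mul]

/-- Negation commutes with substitutions, so it maps `GL₂(ℤ)`-orbits to `GL₂(ℤ)`-orbits. [folklore] -/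
theorem gl2zOrbit_neg_one_smul (f : BinaryQuartic ℤ) :
    gl2zOrbit ((-1 : ℤ) • f) = (fun g ↦ (-1 : ℤ) • g) '' gl2zOrbit f := by
  ext g
  simp only [gl2zOrbit, Set.mem_setOf_eq, Set.mem_image]
  constructor
  · rintro ⟨γ, hγ, rfl⟩
    exact ⟨f.subst γ, ⟨γ, hγ, rfl⟩, (smul_subst _ _ _).symm⟩
  · rintro ⟨g', ⟨γ, hγ, rfl⟩, rfl⟩
    exact ⟨γ, hγ, (smul_subst _ _ _).symm⟩

/-- Negating twice is the identity on sets of forms. [folklore] -/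
theorem image_neg_image_neg (S : Set (BinaryQuartic ℤ)) :
    (fun g ↦ (-1 : ℤ) • g) '' ((fun g ↦ (-1 : ℤ) • g) '' S) = S := by
  rw [Set.image_image]
  simp only [neg_one_smul_neg_one_smul, Set.image_id']

/-! ## `N(V_ℤ^{(2)}; X) = 2 N(V_ℤ^{(2+)}; X)` -/

/-- The orbits of negative definite irreducible forms of height `< X` are the negatives of the
orbits of the positive definite ones. [cite: BhargavaShankarAnnals2015, §2.1 and §5.4 eq. (31) (third line)] -/
theorem orbits_negDefinite_eq (Y : ℝ) :
    gl2zOrbit '' {f | (-1 : ℤ) • f ∈ posDefinite ∧ f.IsIrreducible ∧ f.height < Y} =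
      (fun O ↦ (fun g ↦ (-1 : ℤ) • g) '' O) ''
        (gl2zOrbit '' {f | f ∈ posDefinite ∧ f.IsIrreducible ∧ f.height < Y}) := by
  ext O
  simp only [Set.mem_image, Set.mem_setOf_eq]
  constructor
  · rintro ⟨f, ⟨hf, hirr, hY⟩, rfl⟩
    refine ⟨gl2zOrbit ((-1 : ℤ) • f), ⟨(-1 : ℤ) • f, ⟨hf, ?_, ?_⟩, rfl⟩, ?_⟩
    · rwa [isIrreducible_neg_one_smul_iff]
    · rwa [height_neg_one_smul]
    · rw [gl2zOrbit_neg_one_smul, image_neg_image_neg]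
  · rintro ⟨_, ⟨f, ⟨hf, hirr, hY⟩, rfl⟩, rfl⟩
    refine ⟨(-1 : ℤ) • f, ⟨?_, ?_, ?_⟩, gl2zOrbit_neg_one_smul f⟩
    · rwa [neg_one_smul_neg_one_smul]
    · rwa [isIrreducible_neg_one_smul_iff]
    · rwa [height_neg_one_smul]

/-- **`N(V_ℤ^{(2)}; X) = 2·N(V_ℤ^{(2+)}; X)`**: the definite irreducible classes of height `< X`
split evenly into positive and negative definite ones, `f ↦ −f` being a bijection of orbits
(Bhargava–Shankar 2015, §2: `N(V_ℤ^{(2+)};X)` and `N(V_ℤ^{(2−)};X)` contribute equally,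
`(1/4 + 1/4)·Vol(R₁⁺)` in eq. (31)). [cite: BhargavaShankarAnnals2015, §2.1 and §5.4 eq. (31) (third line)] -/
theorem gl2zClassCount_noRealRoots (Y : ℝ) :
    gl2zClassCount noRealRoots Y = 2 * gl2zClassCount posDefinite Y := by
  unfold gl2zClassCount
  set P := gl2zOrbit '' {f | f ∈ posDefinite ∧ f.IsIrreducible ∧ f.height < Y} with hP
  set Nn := gl2zOrbit '' {f | (-1 : ℤ) • f ∈ posDefinite ∧ f.IsIrreducible ∧ f.height < Y} with hNn
  have hunion : gl2zOrbit '' {f | f ∈ noRealRoots ∧ f.IsIrreducible ∧ f.height < Y} = P ∪ Nn := by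
    rw [hP, hNn, ← Set.image_union]
    congr 1
    ext f
    simp only [Set.mem_setOf_eq, Set.mem_union, mem_noRealRoots_iff_posDefinite]
    tauto
  have hdisj : Disjoint P Nn := by
    rw [Set.disjoint_left]
    rintro O ⟨f, ⟨hf, -, -⟩, rfl⟩ ⟨g, ⟨hg, -, -⟩, hO⟩
    have hfg : GL2ZEquiv g f := by
      have : f ∈ gl2zOrbit g := by rw [hO]; exact GL2ZEquiv.refl f
      exact this
    have hnegequiv : GL2ZEquiv ((-1 : ℤ) • g) ((-1 : ℤ) • f) := by
      obtain ⟨γ, hγ, rfl⟩ := hfg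
      exact ⟨γ, hγ, (smul_subst _ _ _).symm⟩
    exact not_posDefinite_and_neg hf ((GL2ZEquiv.mem_posDefinite_iff hnegequiv).mpr hg)
  have hinj : Function.Injective (fun O : Set (BinaryQuartic ℤ) ↦ (fun g ↦ (-1 : ℤ) • g) '' O) := by
    intro O O' h
    have := congrArg (fun S : Set (BinaryQuartic ℤ) ↦ (fun g ↦ (-1 : ℤ) • g) '' S) h
    simpa only [image_neg_image_neg] using this
  have hcard : Nn.ncard = P.ncard := by
    rw [hNn, orbits_negDefinite_eq, ← hP, Set.ncard_image_of_injective _ hinj]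
  rw [hunion]
  by_cases hfin : P.Finite
  · have hfinN : Nn.Finite := by
      rw [hNn, orbits_negDefinite_eq, ← hP]; exact hfin.image _
    rw [Set.ncard_union_eq hdisj hfin hfinN, hcard]; ring
  · have hinfN : Nn.Infinite := by
      intro hfinN
      apply hfin
      have : P = (fun O ↦ (fun g ↦ (-1 : ℤ) • g) '' O) '' Nn := by
        rw [hNn, orbits_negDefinite_eq, ← hP, Set.image_image]
        simp only [image_neg_image_neg, Set.image_id']
      rw [this]; exact hfinN.image _
    rw [(Set.infinite_union.mpr (Or.inl hfin)).ncard, Set.Infinite.ncard hfin]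

/-! ## Additivity of `N(·; X)` over the three real types -/

/-- **`N(V_ℤ^{(0)} ∪ V_ℤ^{(2+)} ∪ V_ℤ^{(1)}; X) = N(V_ℤ^{(0)};X) + N(V_ℤ^{(2+)};X) + N(V_ℤ^{(1)};X)`**
when the three orbit sets are finite: the orbit families are pairwise disjoint, since `Δ`,
definiteness and positive definiteness are `GL₂(ℤ)`-invariant and a form with `Δ < 0` is not
definite. [cite: BhargavaShankarAnnals2015, §2.1 and §5.4 eq. (31) (third line)] -/
theorem gl2zClassCount_union_three (Y : ℝ)
    (h0 : (gl2zOrbit '' {f | f ∈ fourRealRoots ∧ f.IsIrreducible ∧ f.height < Y}).Finite)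
    (h2 : (gl2zOrbit '' {f | f ∈ posDefinite ∧ f.IsIrreducible ∧ f.height < Y}).Finite)
    (h1 : (gl2zOrbit '' {f | f ∈ twoRealRoots ∧ f.IsIrreducible ∧ f.height < Y}).Finite) :
    gl2zClassCount (fourRealRoots ∪ posDefinite ∪ twoRealRoots) Y =
      gl2zClassCount fourRealRoots Y + gl2zClassCount posDefinite Y + gl2zClassCount twoRealRoots Y := by
  unfold gl2zClassCount
  set O0 := gl2zOrbit '' {f | f ∈ fourRealRoots ∧ f.IsIrreducible ∧ f.height < Y}
  set O2 := gl2zOrbit '' {f | f ∈ posDefinite ∧ f.IsIrreducible ∧ f.height < Y}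
  set O1 := gl2zOrbit '' {f | f ∈ twoRealRoots ∧ f.IsIrreducible ∧ f.height < Y}
  have hunion : gl2zOrbit '' {f | f ∈ fourRealRoots ∪ posDefinite ∪ twoRealRoots ∧
      f.IsIrreducible ∧ f.height < Y} = O0 ∪ O2 ∪ O1 := by
    rw [← Set.image_union, ← Set.image_union]
    congr 1
    ext f
    simp only [Set.mem_setOf_eq, Set.mem_union]
    tauto
  -- orbits determine the real type
  have horb : ∀ {f g : BinaryQuartic ℤ}, gl2zOrbit f = gl2zOrbit g → GL2ZEquiv g f := by
    intro f g h
    have : f ∈ gl2zOrbit g := by rw [← h]; exact GL2ZEquiv.refl f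
    exact this
  have hd02 : Disjoint O0 O2 := by
    rw [Set.disjoint_left]
    rintro O ⟨f, ⟨hf, -, -⟩, rfl⟩ ⟨g, ⟨hg, -, -⟩, hO⟩
    have hfpos : f ∈ posDefinite := (GL2ZEquiv.mem_posDefinite_iff (horb hO.symm)).mpr hg
    exact hf.2 (posDefinite_subset_noRealRoots hfpos)
  have hd01 : Disjoint O0 O1 := by
    rw [Set.disjoint_left]
    rintro O ⟨f, ⟨hf, -, -⟩, rfl⟩ ⟨g, ⟨hg, -, -⟩, hO⟩
    have hftwo : f ∈ twoRealRoots := (GL2ZEquiv.mem_twoRealRoots_iff (horb hO.symm)).mpr hg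
    exact lt_asymm hf.1 hftwo
  have hd21 : Disjoint O2 O1 := by
    rw [Set.disjoint_left]
    rintro O ⟨f, ⟨hf, -, -⟩, rfl⟩ ⟨g, ⟨hg, -, -⟩, hO⟩
    have hftwo : f ∈ twoRealRoots := (GL2ZEquiv.mem_twoRealRoots_iff (horb hO.symm)).mpr hg
    exact not_mem_noRealRoots_of_mem_twoRealRoots hftwo (posDefinite_subset_noRealRoots hf)
  rw [hunion, Set.ncard_union_eq (Disjoint.union_left hd01 hd21) (h0.union h2) h1,
    Set.ncard_union_eq hd02 h0 h2]

end BinaryQuartic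

end Literature.NumberTheory.EllipticCurves

end
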